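import Literature.MathematicalPhysics.QuantumLattice.YangMillsClassicalBianchiProofs
import Literature.MathematicalPhysics.QuantumLattice.YangMillsHeatFlowEnergyInterval
import HarnessLib

/-!
# The Yang–Mills stress–energy tensor and its divergence identity (Waldron 2019, §2)

Step one of the printed proof of Waldron's Theorem 1.1 (A. Waldron, *Long-time existence for
Yang–Mills flow*, Invent. math. 217 (2019), §2 "Stress-energy identities"), on which the named
fact `Literature.MathematicalPhysics.QuantumLattice.Waldron2019_yangMillsFlow_flatTorus` rests
(`Waldron2019_yangMillsFlow_flatTorus_of_thm11`): the stress–energy tensor of a connection and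
the pointwise identities (2.1)–(2.2) behind the weighted energy identity (2.5)/(2.9).

Setting and conventions (those of `YangMillsClassical` / `YangMillsHeatFlowEnergy`): flat space
`E` (real inner product space), coefficients `M_m(ℂ)` with the Frobenius (Hilbert–Schmidt) real
inner product (`frobeniusInnerProductSpace`, local instance), `𝔲(m)`-valued connections
(`skewAdjoint.submodule`, needed for `Ad`-invariance), an orthonormal frame `b`,
`F_{ij} = curvature A x (b i) (b j)`, `D_u = covDeriv A · x u`, energy density
`e = ymDensityOfBasis b A x = ∑_{i<j} ‖F_{ij}‖² = ½ ∑_{i,j} ‖F_{ij}‖²` (Waldron's `|F|²`), covariant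
divergence `(div F)_k = ∑ᵢ Dᵢ F_{ik}` (`= divCurvature`, `= −(D^*F)_k`).

* `frobenius_inner_lie_left_add_right`, `frobenius_inner_lie_self` — infinitesimal
  `Ad`-invariance `⟨[a,X],Y⟩ + ⟨X,[a,Y]⟩ = 0`, `⟨X,[a,X]⟩ = 0` (`a ∈ 𝔲(m)`);
* `fderiv_frobenius_inner_eq_covDeriv` — covariant Leibniz rule `∂_u⟨φ,ψ⟩ = ⟨D_uφ,ψ⟩ + ⟨φ,D_uψ⟩`;
* `covDeriv_fun_neg`, `covDeriv_curvature_bianchi` — the Bianchi identity in a frame,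
  `D_u F(v,w) = D_v F(u,w) + D_w F(v,u)`;
* `sum_sum_inner_curvature_covDeriv_eq_half` — its contraction
  `∑_{ik} ⟨F_{ik}, D_i F_{jk}⟩ = ½ ∑_{ik} ⟨F_{ik}, D_j F_{ik}⟩` (Waldron, display after (2.1));
* `fderiv_ymDensityOfBasis_eq` — `∂_u e = ∑_{ik} ⟨F_{ik}, D_u F_{ik}⟩`;
* `ymStressEnergyOfBasis b A x i j = ∑_k ⟨F_{ik}, F_{jk}⟩ − ½ δ_{ij} e` — the **stress–energy
  tensor** `S_{ij}` (Waldron §2, first display; with the present normalisation of `e` the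
  trace-free correction reads `½ δ_{ij} e`), symmetric (`ymStressEnergyOfBasis_symm`), trace-free
  in dimension four (`sum_ymStressEnergyOfBasis_diag_eq_zero`), bounded by the energy density
  (`abs_ymStressEnergyOfBasis_le`), `C^k` for `C^{k+1}` connections
  (`contDiff_ymStressEnergyOfBasis`);
* `sum_fderiv_ymStressEnergyOfBasis_eq` — **the divergence identity (2.2)**
  `∑ᵢ ∂ᵢ S_{ij} = ∑_k ⟨(div F)_k, F_{jk}⟩` (`= ⟨D^*F_k, F_{kj}⟩`), for `C²` `𝔲(m)`-valued connections;
  `sum_fderiv_ymStressEnergyOfBasis_eq_divCurvature` — the same with `divCurvature`.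

References: A. Waldron, *Long-time existence for Yang–Mills flow*, Invent. math. 217 (2019),
1069–1147, §2, (2.1)–(2.2) [Waldron2019]; S. K. Donaldson, P. B. Kronheimer, *The Geometry of
Four-Manifolds* (1990), (2.1.21) (Bianchi identity) [DonaldsonKronheimer1990].
-/

noncomputable section

open scoped ContDiff Topology RealInnerProductSpace Matrix
open Set Filter

namespace Literature.MathematicalPhysics.QuantumLattice

/-! ### Linearity of the covariant derivative in the section -/

section CovDerivAlgebra

variable {E : Type*} [NormedAddCommGroup E] [InnerProductSpace ℝ E]
variable {𝔸 : Type*} [NormedRing 𝔸] [NormedAlgebra ℝ 𝔸]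

/-- `D_u(−φ) = −D_uφ`. [folklore] -/
theorem covDeriv_fun_neg (A : Connection E 𝔸) (φ : E → 𝔸) (x u : E) :
    covDeriv A (fun y => -φ y) x u = -covDeriv A φ x u := by
  simp only [covDeriv, fderiv_fun_neg, neg_apply, Ring.lie_def, mul_neg, neg_mul]
  abel

/-- `D_u(φ + ψ) = D_uφ + D_uψ` for sections differentiable at the point. [folklore] -/
theorem covDeriv_fun_add (A : Connection E 𝔸) {φ ψ : E → 𝔸} {x : E}
    (hφ : DifferentiableAt ℝ φ x) (hψ : DifferentiableAt ℝ ψ x) (u : E) :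
    covDeriv A (fun y => φ y + ψ y) x u = covDeriv A φ x u + covDeriv A ψ x u := by
  simp only [covDeriv, fderiv_fun_add hφ hψ, add_apply, Ring.lie_def, mul_add, add_mul]
  abel

/-- `D_u(∑ᵢ φᵢ) = ∑ᵢ D_u φᵢ` for sections differentiable at the point. [folklore] -/
theorem covDeriv_fun_sum {κ : Type*} (s : Finset κ) (A : Connection E 𝔸) {φ : κ → E → 𝔸} {x : E}
    (hφ : ∀ i ∈ s, DifferentiableAt ℝ (φ i) x) (u : E) :
    covDeriv A (fun y => ∑ i ∈ s, φ i y) x u = ∑ i ∈ s, covDeriv A (φ i) x u := by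
  simp only [covDeriv, fderiv_fun_sum hφ, FunLike.coe_sum, Finset.sum_apply, Ring.lie_def,
    Finset.mul_sum, Finset.sum_mul, Finset.sum_add_distrib, Finset.sum_sub_distrib]

/-- For a `C^{k+1}` section and a `C^k` connection, `y ↦ D_u φ(y)` is `C^k`. [folklore] -/
theorem contDiff_covDeriv_apply {k : WithTop ℕ∞} {A : Connection E 𝔸} {φ : E → 𝔸}
    (hA : ContDiff ℝ k A) (hφ : ContDiff ℝ (k + 1) φ) (u : E) :
    ContDiff ℝ k (fun y => covDeriv A φ y u) := by
  unfold covDeriv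
  have h1 : ContDiff ℝ k (fun y => fderiv ℝ φ y u) :=
    (hφ.fderiv_right le_rfl).clm_apply contDiff_const
  have h2 : ContDiff ℝ k (fun y => A y u) := hA.clm_apply contDiff_const
  have h3 : ContDiff ℝ k φ := hφ.of_le le_self_add
  simp only [Ring.lie_def]
  exact h1.add ((h2.mul h3).sub (h3.mul h2))

/-- For a `C^{k+2}` connection, `y ↦ D_w F(y)(u, v)` is `C^k`. [folklore] -/
theorem contDiff_covDeriv_curvature_apply {k : WithTop ℕ∞} {A : Connection E 𝔸}
    (hA : ContDiff ℝ (k + 2) A) (u v w : E) :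
    ContDiff ℝ k (fun y => covDeriv A (fun z => curvature A z u v) y w) := by
  have h2 : (k + 2 : WithTop ℕ∞) = (k + 1) + 1 := by
    rw [add_assoc]; norm_num
  rw [h2] at hA
  exact contDiff_covDeriv_apply (hA.of_le (by simp [add_assoc]))
    (contDiff_curvature_apply hA u v) w

end CovDerivAlgebra

section StressEnergy

open scoped Matrix.Norms.Frobenius

attribute [local instance] frobeniusInnerProductSpace

variable {m : Type*} [Fintype m] [DecidableEq m]

/-! ### Infinitesimal `Ad`-invariance of the Hilbert–Schmidt inner product -/

omit [DecidableEq m] in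
/-- `⟨[a, X], Y⟩ + ⟨X, [a, Y]⟩ = 0` for skew-adjoint `a` (infinitesimal `Ad`-invariance of the
real Hilbert–Schmidt inner product under `𝔲(m)`). [folklore] -/
theorem frobenius_inner_lie_left_add_right (a X Y : Matrix m m ℂ) (ha : star a = -a) :
    ⟪⁅a, X⁆, Y⟫ + ⟪X, ⁅a, Y⁆⟫ = 0 := by
  rw [frobenius_inner_lie_right a X Y ha]
  ring

omit [DecidableEq m] in
/-- `⟨X, [a, X]⟩ = 0` for skew-adjoint `a`. [folklore] -/
theorem frobenius_inner_lie_self (a X : Matrix m m ℂ) (ha : star a = -a) : ⟪X, ⁅a, X⁆⟫ = 0 := by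
  have h := frobenius_inner_lie_right a X X ha
  rw [real_inner_comm X ⁅a, X⁆] at h
  linarith

variable {E : Type*} [NormedAddCommGroup E] [InnerProductSpace ℝ E]

/-- **Covariant Leibniz rule.** For a connection which is `𝔲(m)`-valued at `x` in the direction
`u` and sections `φ, ψ` differentiable at `x`,
`∂_u ⟨φ, ψ⟩(x) = ⟨D_u φ(x), ψ(x)⟩ + ⟨φ(x), D_u ψ(x)⟩` (the bracket terms cancel by
`Ad`-invariance). Donaldson–Kronheimer §2.1.2. [folklore] -/
theorem fderiv_frobenius_inner_eq_covDeriv {A : Connection E (Matrix m m ℂ)}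
    {φ ψ : E → Matrix m m ℂ} {x : E} (hφ : DifferentiableAt ℝ φ x) (hψ : DifferentiableAt ℝ ψ x)
    (u : E) (hu : A x u ∈ skewAdjoint.submodule ℝ (Matrix m m ℂ)) :
    fderiv ℝ (fun y => ⟪φ y, ψ y⟫) x u = ⟪covDeriv A φ x u, ψ x⟫ + ⟪φ x, covDeriv A ψ x u⟫ := by
  rw [fderiv_inner_apply ℝ hφ hψ u]
  have h := frobenius_inner_lie_left_add_right (A x u) (φ x) (ψ x) (skewAdjoint.mem_iff.mp hu)
  simp only [covDeriv, inner_add_left, inner_add_right]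
  linarith

/-- Special case `φ = ψ`: `∂_u ‖φ‖²(x) = 2 ⟨φ(x), D_u φ(x)⟩`. [folklore] -/
theorem fderiv_norm_sq_eq_two_inner_covDeriv {A : Connection E (Matrix m m ℂ)}
    {φ : E → Matrix m m ℂ} {x : E} (hφ : DifferentiableAt ℝ φ x)
    (u : E) (hu : A x u ∈ skewAdjoint.submodule ℝ (Matrix m m ℂ)) :
    fderiv ℝ (fun y => ‖φ y‖ ^ 2) x u = 2 * ⟪φ x, covDeriv A φ x u⟫ := by
  have heq : (fun y => ‖φ y‖ ^ 2) = fun y => ⟪φ y, φ y⟫ :=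
    funext fun y => (real_inner_self_eq_norm_sq (φ y)).symm
  rw [heq, fderiv_frobenius_inner_eq_covDeriv hφ hφ u hu, real_inner_comm (φ x)]
  ring

/-! ### The Bianchi identity in a frame -/

omit [DecidableEq m] in
/-- **Bianchi identity in a frame.** For a `C²` connection and vectors `u v w`,
`D_u F(v, w) = D_v F(u, w) + D_w F(v, u)` (from the cyclic form
`D_u F(v,w) + D_v F(w,u) + D_w F(u,v) = 0` and antisymmetry). Donaldson–Kronheimer (2.1.21).
[folklore] -/
theorem covDeriv_curvature_bianchi {𝔸 : Type*} [NormedRing 𝔸] [NormedAlgebra ℝ 𝔸]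
    (A : Connection E 𝔸) (hA : ContDiff ℝ 2 A) (x u v w : E) :
    covDeriv A (fun y => curvature A y v w) x u =
      covDeriv A (fun y => curvature A y u w) x v +
        covDeriv A (fun y => curvature A y v u) x w := by
  have hcyc := covDeriv_curvature_cyclic_holds A hA x u v w
  have h1 : covDeriv A (fun y => curvature A y w u) x v =
      -covDeriv A (fun y => curvature A y u w) x v := by
    rw [← covDeriv_fun_neg]
    congr 1
    funext y
    exact curvature_antisymm A y w u
  have h2 : covDeriv A (fun y => curvature A y u v) x w =
      -covDeriv A (fun y => curvature A y v u) x w := by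
    rw [← covDeriv_fun_neg]
    congr 1
    funext y
    exact curvature_antisymm A y u v
  rw [h1, h2] at hcyc
  rw [← sub_eq_zero, ← hcyc]
  abel

variable {ι : Type*} [Fintype ι]

/-- **Contracted Bianchi identity** (Waldron 2019, display after (2.1)): in an orthonormal frame,
`∑_{i,k} ⟨F_{ik}, D_i F_{jk}⟩ = ½ ∑_{i,k} ⟨F_{ik}, D_j F_{ik}⟩` for a `C²` connection.
[cite: Waldron2019, §2 (2.1)–(2.2)] -/
theorem sum_sum_inner_curvature_covDeriv_eq_half (b : OrthonormalBasis ι ℝ E)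
    (A : Connection E (Matrix m m ℂ)) (hA : ContDiff ℝ 2 A) (x : E) (j : ι) :
    ∑ i, ∑ k, ⟪curvature A x (b i) (b k),
        covDeriv A (fun y => curvature A y (b j) (b k)) x (b i)⟫ =
      (1 / 2) * ∑ i, ∑ k, ⟪curvature A x (b i) (b k),
        covDeriv A (fun y => curvature A y (b i) (b k)) x (b j)⟫ := by
  set T := ∑ i, ∑ k, ⟪curvature A x (b i) (b k),
    covDeriv A (fun y => curvature A y (b j) (b k)) x (b i)⟫ with hT
  set U := ∑ i, ∑ k, ⟪curvature A x (b i) (b k),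
    covDeriv A (fun y => curvature A y (b i) (b k)) x (b j)⟫ with hU
  -- Bianchi: `D_i F_{jk} = D_j F_{ik} + D_k F_{ji}`
  have hB : T = U + ∑ i, ∑ k, ⟪curvature A x (b i) (b k),
      covDeriv A (fun y => curvature A y (b j) (b i)) x (b k)⟫ := by
    simp only [hT, hU, ← Finset.sum_add_distrib, ← inner_add_right]
    refine Finset.sum_congr rfl fun i _ => Finset.sum_congr rfl fun k _ => ?_
    rw [covDeriv_curvature_bianchi A hA x (b i) (b j) (b k)]
  -- the last sum is `−T` after renaming `i ↔ k` and using antisymmetry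
  have hlast : ∑ i, ∑ k, ⟪curvature A x (b i) (b k),
      covDeriv A (fun y => curvature A y (b j) (b i)) x (b k)⟫ = -T := by
    rw [hT, Finset.sum_comm, ← Finset.sum_neg_distrib]
    refine Finset.sum_congr rfl fun i _ => ?_
    rw [← Finset.sum_neg_distrib]
    refine Finset.sum_congr rfl fun k _ => ?_
    rw [curvature_antisymm A x (b k) (b i), inner_neg_left]
  rw [hlast] at hB
  linarith

variable [LinearOrder ι]

/-! ### The derivative of the energy density -/

/-- For a `C²` connection, `𝔲(m)`-valued at `x` in the direction `u`,
`∂_u e(x) = ∑_{i,k} ⟨F_{ik}(x), D_u F_{ik}(x)⟩` where `e = ∑_{i<k} ‖F_{ik}‖² = ½ ∑_{i,k} ‖F_{ik}‖²`.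
[folklore] -/
theorem fderiv_ymDensityOfBasis_eq (b : OrthonormalBasis ι ℝ E) {A : Connection E (Matrix m m ℂ)}
    (hA : ContDiff ℝ 2 A) (x u : E) (hu : A x u ∈ skewAdjoint.submodule ℝ (Matrix m m ℂ)) :
    fderiv ℝ (fun y => ymDensityOfBasis b A y) x u =
      ∑ i, ∑ k, ⟪curvature A x (b i) (b k),
        covDeriv A (fun y => curvature A y (b i) (b k)) x u⟫ := by
  have hFd : ∀ i k, DifferentiableAt ℝ (fun y => curvature A y (b i) (b k)) x :=
    fun i k => (differentiable_curvature_apply hA (b i) (b k)) x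
  have hsq : ∀ i k, HasFDerivAt (fun y => ‖curvature A y (b i) (b k)‖ ^ 2)
      (fderiv ℝ (fun y => ‖curvature A y (b i) (b k)‖ ^ 2) x) x :=
    fun i k => ((hFd i k).norm_sq ℝ).hasFDerivAt
  have hsum : HasFDerivAt (fun y => ∑ i, ∑ k, ‖curvature A y (b i) (b k)‖ ^ 2)
      (∑ i, ∑ k, fderiv ℝ (fun y => ‖curvature A y (b i) (b k)‖ ^ 2) x) x :=
    HasFDerivAt.fun_sum fun i _ => HasFDerivAt.fun_sum fun k _ => hsq i k
  have hh : HasFDerivAt (fun y => ymDensityOfBasis b A y)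
      ((2 : ℝ)⁻¹ • ∑ i, ∑ k, fderiv ℝ (fun y => ‖curvature A y (b i) (b k)‖ ^ 2) x) x := by
    have heq : (fun y => ymDensityOfBasis b A y) =
        fun y => (∑ i, ∑ k, ‖curvature A y (b i) (b k)‖ ^ 2) * (2 : ℝ)⁻¹ := by
      funext y
      rw [ymDensityOfBasis_eq_half_sum b A y, div_eq_mul_inv]
    rw [heq]
    exact hsum.mul_const (2 : ℝ)⁻¹
  rw [hh.fderiv]
  simp only [FunLike.coe_smul, FunLike.coe_sum, Pi.smul_apply,
    Finset.sum_apply, smul_eq_mul, Finset.mul_sum]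
  refine Finset.sum_congr rfl fun i _ => Finset.sum_congr rfl fun k _ => ?_
  rw [fderiv_norm_sq_eq_two_inner_covDeriv (hFd i k) u hu]
  ring

/-! ### The stress–energy tensor -/

/-- **The Yang–Mills stress–energy tensor** in an orthonormal frame `b`:
`S_{ij}(x) = ∑_k ⟨F_{ik}(x), F_{jk}(x)⟩ − ½ δ_{ij} e(x)`, where `F_{ij} = F_A(x)(bᵢ, bⱼ)` and
`e = ymDensityOfBasis b A x = ∑_{i<j} ‖F_{ij}‖²` (so that `½ δ_{ij} e = ¼ δ_{ij} ∑_{k,l} ‖F_{kl}‖²`;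
this is Waldron's `S_{ij} = g^{kl}⟨F_{ik}, F_{jl}⟩ − ¼ g_{ij} |F|²`, trace-free in dimension four).
Coefficients `M_m(ℂ)` with the real Hilbert–Schmidt inner product.
[cite: Waldron2019, §2, first display] -/
def ymStressEnergyOfBasis (b : OrthonormalBasis ι ℝ E) (A : Connection E (Matrix m m ℂ)) (x : E)
    (i j : ι) : ℝ :=
  ∑ k, ⟪curvature A x (b i) (b k), curvature A x (b j) (b k)⟫ -
    if i = j then ymDensityOfBasis b A x / 2 else 0

/-- Unfolding lemma for the stress–energy tensor. [cite: Waldron2019, §2, first display] -/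
theorem ymStressEnergyOfBasis_apply (b : OrthonormalBasis ι ℝ E) (A : Connection E (Matrix m m ℂ))
    (x : E) (i j : ι) :
    ymStressEnergyOfBasis b A x i j =
      ∑ k, ⟪curvature A x (b i) (b k), curvature A x (b j) (b k)⟫ -
        if i = j then ymDensityOfBasis b A x / 2 else 0 :=
  rfl

/-- The stress–energy tensor is symmetric. [cite: Waldron2019, §2] -/
theorem ymStressEnergyOfBasis_symm (b : OrthonormalBasis ι ℝ E) (A : Connection E (Matrix m m ℂ))
    (x : E) (i j : ι) :
    ymStressEnergyOfBasis b A x i j = ymStressEnergyOfBasis b A x j i := by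
  unfold ymStressEnergyOfBasis
  congr 1
  · exact Finset.sum_congr rfl fun k _ => real_inner_comm _ _
  · by_cases h : i = j
    · subst h; rfl
    · rw [if_neg h, if_neg (Ne.symm h)]

/-- **Trace-free in dimension four**: `∑ᵢ S_{ii} = ∑_{i,k} ‖F_{ik}‖² − (card ι / 2) e = 2e − 2e = 0`
when the frame has four elements. [cite: Waldron2019, §2 ("S_{ij} is traceless in dimension four")] -/
theorem sum_ymStressEnergyOfBasis_diag_eq_zero (b : OrthonormalBasis ι ℝ E)
    (A : Connection E (Matrix m m ℂ)) (x : E) (hι : Fintype.card ι = 4) :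
    ∑ i, ymStressEnergyOfBasis b A x i i = 0 := by
  unfold ymStressEnergyOfBasis
  simp only [if_true, Finset.sum_sub_distrib, Finset.sum_const, Finset.card_univ, hι,
    nsmul_eq_mul, Nat.cast_ofNat, real_inner_self_eq_norm_sq]
  rw [ymDensityOfBasis_eq_half_sum b A x]
  ring

/-- **Pointwise bound** `|S_{ij}| ≤ (5/2) e`: `|∑_k ⟨F_{ik}, F_{jk}⟩| ≤ ½ ∑_k (‖F_{ik}‖² + ‖F_{jk}‖²) ≤ 2e`
and `½ δ_{ij} e ≤ ½ e`. [cite: Waldron2019, §2 (2.7) ("the obvious bound")] -/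
theorem abs_ymStressEnergyOfBasis_le (b : OrthonormalBasis ι ℝ E) (A : Connection E (Matrix m m ℂ))
    (x : E) (i j : ι) :
    |ymStressEnergyOfBasis b A x i j| ≤ 5 / 2 * ymDensityOfBasis b A x := by
  set F : ι → ι → Matrix m m ℂ := fun i k => curvature A x (b i) (b k) with hF
  have he : ymDensityOfBasis b A x = (∑ i, ∑ k, ‖F i k‖ ^ 2) / 2 := ymDensityOfBasis_eq_half_sum b A x
  have he0 : 0 ≤ ymDensityOfBasis b A x := ymDensityOfBasis_nonneg b A x
  -- a row of the double sum is bounded by the double sum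
  have hrow : ∀ i, ∑ k, ‖F i k‖ ^ 2 ≤ ∑ i', ∑ k, ‖F i' k‖ ^ 2 := fun i =>
    Finset.single_le_sum (f := fun i' => ∑ k, ‖F i' k‖ ^ 2)
      (fun i' _ => Finset.sum_nonneg fun k _ => by positivity) (Finset.mem_univ i)
  have h1 : |∑ k, ⟪F i k, F j k⟫| ≤ 2 * ymDensityOfBasis b A x := by
    calc |∑ k, ⟪F i k, F j k⟫| ≤ ∑ k, |⟪F i k, F j k⟫| := Finset.abs_sum_le_sum_abs _ _
      _ ≤ ∑ k, (‖F i k‖ ^ 2 + ‖F j k‖ ^ 2) / 2 := by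
          refine Finset.sum_le_sum fun k _ => ?_
          have hcs := abs_real_inner_le_norm (F i k) (F j k)
          nlinarith [sq_nonneg (‖F i k‖ - ‖F j k‖), norm_nonneg (F i k), norm_nonneg (F j k)]
      _ = ((∑ k, ‖F i k‖ ^ 2) + ∑ k, ‖F j k‖ ^ 2) / 2 := by
          rw [← Finset.sum_add_distrib, Finset.sum_div]
      _ ≤ ((∑ i', ∑ k, ‖F i' k‖ ^ 2) + ∑ i', ∑ k, ‖F i' k‖ ^ 2) / 2 := by
          have h := add_le_add (hrow i) (hrow j)
          linarith
      _ = 2 * ymDensityOfBasis b A x := by rw [he]; ring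
  have h2 : |(if i = j then ymDensityOfBasis b A x / 2 else 0)| ≤ ymDensityOfBasis b A x / 2 := by
    split_ifs
    · rw [abs_of_nonneg (by positivity)]
    · rw [abs_zero]; positivity
  calc |ymStressEnergyOfBasis b A x i j|
      = |∑ k, ⟪F i k, F j k⟫ - if i = j then ymDensityOfBasis b A x / 2 else 0| := rfl
    _ ≤ |∑ k, ⟪F i k, F j k⟫| + |(if i = j then ymDensityOfBasis b A x / 2 else 0)| :=
        abs_sub _ _
    _ ≤ 2 * ymDensityOfBasis b A x + ymDensityOfBasis b A x / 2 := add_le_add h1 h2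
    _ = 5 / 2 * ymDensityOfBasis b A x := by ring

/-- The energy density of a `C^{k+1}` connection is `C^k`. [folklore] -/
theorem contDiff_ymDensityOfBasis {k : WithTop ℕ∞} (b : OrthonormalBasis ι ℝ E)
    {A : Connection E (Matrix m m ℂ)} (hA : ContDiff ℝ (k + 1) A) :
    ContDiff ℝ k (fun y => ymDensityOfBasis b A y) := by
  have heq : (fun y => ymDensityOfBasis b A y) =
      fun y => (∑ i, ∑ j, ‖curvature A y (b i) (b j)‖ ^ 2) / 2 :=
    funext fun y => ymDensityOfBasis_eq_half_sum b A y
  rw [heq]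
  refine ContDiff.div_const (ContDiff.sum fun i _ => ContDiff.sum fun j _ => ?_) 2
  exact (contDiff_curvature_apply hA (b i) (b j)).norm_sq ℝ

/-- The stress–energy tensor of a `C^{k+1}` connection is `C^k`. [folklore] -/
theorem contDiff_ymStressEnergyOfBasis {k : WithTop ℕ∞} (b : OrthonormalBasis ι ℝ E)
    {A : Connection E (Matrix m m ℂ)} (hA : ContDiff ℝ (k + 1) A) (i j : ι) :
    ContDiff ℝ k (fun y => ymStressEnergyOfBasis b A y i j) := by
  unfold ymStressEnergyOfBasis
  refine ContDiff.sub (ContDiff.sum fun l _ => ?_) ?_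
  · exact (contDiff_curvature_apply hA (b i) (b l)).inner ℝ (contDiff_curvature_apply hA (b j) (b l))
  · by_cases h : i = j
    · simp only [if_pos h]
      exact (contDiff_ymDensityOfBasis b hA).div_const 2
    · simp only [if_neg h]
      exact contDiff_const

/-- The stress–energy tensor of a `C²` connection is differentiable. [folklore] -/
theorem differentiable_ymStressEnergyOfBasis (b : OrthonormalBasis ι ℝ E)
    {A : Connection E (Matrix m m ℂ)} (hA : ContDiff ℝ 2 A) (i j : ι) :
    Differentiable ℝ (fun y => ymStressEnergyOfBasis b A y i j) := by
  have h2 : (2 : WithTop ℕ∞) = 1 + 1 := by norm_num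
  rw [h2] at hA
  exact (contDiff_ymStressEnergyOfBasis b hA i j).differentiable one_ne_zero

/-! ### The divergence identity (2.2) -/

/-- **Divergence of the stress–energy tensor** (Waldron 2019, (2.1)–(2.2)). For a `C²`
`𝔲(m)`-valued connection on flat space and an orthonormal frame `b`,
`∑ᵢ ∂_{bᵢ} S_{ij}(x) = ∑_k ⟨∑ᵢ Dᵢ F_{ik}(x), F_{jk}(x)⟩`, i.e. `∇ⁱ S_{ij} = ⟨D^*F_k, F_{kj}⟩` with
`D^*F_k = −∑ᵢ DᵢF_{ik}`. Proof as printed: the covariant Leibniz rule gives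
`∇ᵢS_{ij} = ⟨∇ᵢF_{ik}, F_{jk}⟩ + ⟨F_{ik}, ∇ᵢF_{jk}⟩ − ¼∇ⱼ|F|²` and the contracted Bianchi identity
`⟨F_{ik}, ∇ᵢF_{jk}⟩ = ¼ ∇ⱼ|F|²` cancels the last two terms. [cite: Waldron2019, §2 (2.2)] -/
theorem sum_fderiv_ymStressEnergyOfBasis_eq (b : OrthonormalBasis ι ℝ E)
    {A : Connection E (Matrix m m ℂ)} (hA : ContDiff ℝ 2 A)
    (hval : A.IsValuedIn (skewAdjoint.submodule ℝ (Matrix m m ℂ))) (x : E) (j : ι) :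
    ∑ i, fderiv ℝ (fun y => ymStressEnergyOfBasis b A y i j) x (b i) =
      ∑ k, ⟪∑ i, covDeriv A (fun y => curvature A y (b i) (b k)) x (b i),
        curvature A x (b j) (b k)⟫ := by
  -- notation
  set F : E → ι → ι → Matrix m m ℂ := fun y i k => curvature A y (b i) (b k) with hF
  set DF : ι → ι → ι → Matrix m m ℂ :=
    fun l i k => covDeriv A (fun y => F y i k) x (b l) with hDF
  have hFd : ∀ i k, DifferentiableAt ℝ (fun y => F y i k) x :=
    fun i k => (differentiable_curvature_apply hA (b i) (b k)) x
  have hed : DifferentiableAt ℝ (fun y => ymDensityOfBasis b A y) x := by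
    have h2 : (2 : WithTop ℕ∞) = 1 + 1 := by norm_num
    rw [h2] at hA
    exact ((contDiff_ymDensityOfBasis b hA).differentiable one_ne_zero) x
  -- `S_{ij} = ∑_k ⟨F_{ik}, F_{jk}⟩ − cᵢ e` with `cᵢ = ½ δ_{ij}`
  have hrepr : ∀ i, (fun y => ymStressEnergyOfBasis b A y i j) =
      fun y => (∑ k, ⟪F y i k, F y j k⟫) -
        (if i = j then (2 : ℝ)⁻¹ else 0) * ymDensityOfBasis b A y := by
    intro i
    funext y
    unfold ymStressEnergyOfBasis
    split_ifs <;> ring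
  -- derivative of one component of `S`
  have hS : ∀ i, fderiv ℝ (fun y => ymStressEnergyOfBasis b A y i j) x (b i) =
      ∑ k, (⟪DF i i k, F x j k⟫ + ⟪F x i k, DF i j k⟫) -
        (if i = j then (2 : ℝ)⁻¹ else 0) * fderiv ℝ (fun y => ymDensityOfBasis b A y) x (b i) := by
    intro i
    have hsumd : DifferentiableAt ℝ (fun y => ∑ k, ⟪F y i k, F y j k⟫) x :=
      DifferentiableAt.fun_sum fun k _ => (hFd i k).inner ℝ (hFd j k)
    rw [hrepr i, fderiv_fun_sub hsumd (hed.const_mul _), sub_apply,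
      fderiv_fun_sum fun k _ => (hFd i k).inner ℝ (hFd j k), FunLike.coe_sum,
      Finset.sum_apply, fderiv_const_mul hed, FunLike.coe_smul, Pi.smul_apply,
      smul_eq_mul]
    congr 1
    refine Finset.sum_congr rfl fun k _ => ?_
    exact fderiv_frobenius_inner_eq_covDeriv (hFd i k) (hFd j k) (b i) (hval x (b i))
  rw [Finset.sum_congr rfl fun i _ => hS i, Finset.sum_sub_distrib]
  -- the `δ_{ij}` term picks `i = j`
  have hite : ∑ i, (if i = j then (2 : ℝ)⁻¹ else 0) *
      fderiv ℝ (fun y => ymDensityOfBasis b A y) x (b i) =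
      2⁻¹ * fderiv ℝ (fun y => ymDensityOfBasis b A y) x (b j) := by
    simp only [ite_mul, zero_mul, Finset.sum_ite_eq', Finset.mem_univ, if_true]
  rw [hite, fderiv_ymDensityOfBasis_eq b hA x (b j) (hval x (b j))]
  simp only [Finset.sum_add_distrib]
  rw [sum_sum_inner_curvature_covDeriv_eq_half b A hA x j]
  -- the first double sum is the pairing with the covariant divergence
  have hfirst : ∑ i, ∑ k, ⟪DF i i k, F x j k⟫ = ∑ k, ⟪∑ i, DF i i k, F x j k⟫ := by
    rw [Finset.sum_comm]
    exact Finset.sum_congr rfl fun k _ => (sum_inner _ _ _).symm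
  rw [hfirst]
  ring

variable [FiniteDimensional ℝ E] in
/-- The divergence identity (2.2) with the covariant divergence `divCurvature`
(frame-independent): `∑ᵢ ∂_{bᵢ} S_{ij}(x) = ∑_k ⟨div_A F(x)(b_k), F_{jk}(x)⟩`.
[cite: Waldron2019, §2 (2.2)] -/
theorem sum_fderiv_ymStressEnergyOfBasis_eq_divCurvature (b : OrthonormalBasis ι ℝ E)
    {A : Connection E (Matrix m m ℂ)} (hA : ContDiff ℝ 2 A)
    (hval : A.IsValuedIn (skewAdjoint.submodule ℝ (Matrix m m ℂ))) (x : E) (j : ι) :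
    ∑ i, fderiv ℝ (fun y => ymStressEnergyOfBasis b A y i j) x (b i) =
      ∑ k, ⟪divCurvature A x (b k), curvature A x (b j) (b k)⟫ := by
  rw [sum_fderiv_ymStressEnergyOfBasis_eq b hA hval x j]
  refine Finset.sum_congr rfl fun k _ => ?_
  rw [divCurvature_eq_sum_orthonormalBasis b A hA x (b k)]

/-- **The divergence of `S` is the energy flux of the flow.** Under the Yang–Mills heat equation
the vector field `Wᵢ = ∑ⱼ ⟨F_{ij}, Ȧ_j⟩` of the energy identity
(`hasDerivAt_ymDensityOfBasis_of_flow_on`: `∂ₜ e = 2 ∑ᵢ ∂ᵢ Wᵢ − 2 |div F|²`) is the divergence of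
the stress–energy tensor: with `Ȧ_j = div_A F(b_j)`,
`∑ⱼ ⟨F_{ij}(x), div_A F(x)(b_j)⟩ = ∑_k ∂_{b_k} S_{ki}(x)`; hence Waldron's (2.4)
`½ ∂ₜ|F|² + |D^*F|² = ∇ⁱ∇ʲ S_{ij}`. [cite: Waldron2019, §2 (2.2)–(2.4)] -/
theorem sum_inner_curvature_divCurvature_eq_sum_fderiv_ymStressEnergyOfBasis
    [FiniteDimensional ℝ E] (b : OrthonormalBasis ι ℝ E)
    {A : Connection E (Matrix m m ℂ)} (hA : ContDiff ℝ 2 A)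
    (hval : A.IsValuedIn (skewAdjoint.submodule ℝ (Matrix m m ℂ))) (x : E) (i : ι) :
    ∑ j, ⟪curvature A x (b i) (b j), divCurvature A x (b j)⟫ =
      ∑ k, fderiv ℝ (fun y => ymStressEnergyOfBasis b A y k i) x (b k) := by
  rw [sum_fderiv_ymStressEnergyOfBasis_eq_divCurvature b hA hval x i]
  exact Finset.sum_congr rfl fun j _ => real_inner_comm _ _

end StressEnergy

end Literature.MathematicalPhysics.QuantumLattice
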